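/-
Copyright: statement-level skeleton of a published paper (lit-balaban cell, Phase-2 proof seat p25, gen 15). No proof
claims beyond what the kernel checks below.
-/
import Literature.MathematicalPhysics.QuantumFieldTheory.BalabanImbrieJaffe1984to88.BIJ88VertexExpansion311

/-!
# `BalabanImbrieJaffe1984to88.BIJ88VertexComponents311` — T. Bałaban, J. Imbrie, A. Jaffe, *Effective action and cluster
properties of the abelian Higgs model*, Commun. Math. Phys. **114** (1988) 257–315 [BalabanImbrieJaffe1988], §5.14
p. 311–312 [PDF 55–56] *"For each term, let X be the union of the cubes covering the X_{σ_i} and the regions from the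
random walk expansion. A connected component of X is called complete if a contraction to χ′_{Λ^{(k)}} occurs, if a term
from the random walk expansion occurs, if at least m̄+1 interactions have been differentiated down, or if the term is
constant (all legs contracted). We stop integrating by parts fields in complete components of X. After sufficiently
many integrations by parts, all components of X will be complete. We break up the observable according to the connected
components of X. The components containing contractions to χ′_{Λ^{(k)}}, terms from the random walk expansions, or at
least m̄+1 interactions are called remainder components {X_r}. The other components are called constant components
{X_c}"* — **PRINT'S STOPPING RULE PER COMPONENT, DEFINED AND SHOWN TO TERMINATE AND TO CLASSIFY**: the sequel of p25
gen 15's one-component `BIJ88VertexExpansion311` (its honest-scope item (a)).  A COMPONENT (`Grp`) carries its pending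
legs, its number of contractions to `χ′` and its number of differentiated-down vertices; a contraction joining two
components MERGES them (counts add); integration by parts continues only in incomplete components; the expansion
`cterms` is defined by well-founded recursion on an explicit potential (`pot`) and every term's components are complete
(`cterms_sound`), i.e. constant or remainder (`Grp.isConst_or_isRem_of_complete`).  The identity (nothing lost) and the
coefficient bound are the sibling `BIJ88VertexComponentsExpansion311`.

statement-level skeleton of published theorems with citation tags; proofs where landed; nothing here is a claim
about the Yang–Mills mass gap

PDF held: `paper:balaban1988-cmp114-bij-abelian-higgs-effective-action` (journal page = PDF page + 256); p. 311–312 =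
PDF 55–56 (`p0055.txt` L33–45, `p0056.txt` L1–3 re-read this session).

CITATION HEADER (lean-in-tree rule).  lit-balaban cell (HOME `run/shared/lean/pub/lit-balaban/`), Phase 2, seat p25
gen 15; row **C2.Claim@312** of `HOME/lit-balaban-r16/ROWS-C2-part2.md` (owner r16, referee ref-5; head untouched): the
owner's flip-path item (β) for ALL components (*"so … the classification (b) becomes definable"*).  USED BY NAME,
nothing restated: `BIJ88VertexIbp311.{lmono, vexp}` (for the sibling), Mathlib list/finset calculus.  The combinatorial
component model (components linked by contractions, not by the geometry of cubes) is the one of p25 gen 14's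
`BIJ88IbpComponents312`/`BIJ88ConnectedDiagrams312` (vacuum case).

## What is proved (0 `sorry`, standard axioms, no new `Prop` facts; definitions with bodies: `Grp`, `Grp.complete`,
`Grp.IsConst`, `Grp.IsRem`, `Grp.merge`, `CTerm`, `CTerm.scale/push/bump`, `maxArity`, `gw`, `pot`, `cterms`, `initGrps`)

* §1 components and terms; §2 the potential `pot done todo = Σ_todo (|pend|+1+(M−nv)·A) + Σ_done |pend|` (`A` = maximal
  vertex arity) and the six decrease lemmas (`pot_move`, `pot_head_lt`, `pot_merge_rest`, `pot_merge_done`,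
  `pot_vertex`); **`cterms A ℱ c legs M done todo`** — THE EXPANSION (state = complete components `done`, others
  `todo`; head component complete ⇒ set aside; else its head leg contracts (1) within the component, (2) to another
  incomplete component [merge], (3) to a complete one [merge], (4) to ℱ, (5) to `χ′` [χ′-count +1 ⇒ complete], (6) to a
  vertex [legs appended, vertex count +1; `≥ M = m̄+1` ⇒ complete]; `todo = []` ⇒ terminal).
* §3 **`cterms_sound`** (from complete `done`: every component of every term is complete; `Σ nchi = Σ₀ nchi + |dirs|`;
  `Σ nv = Σ₀ nv + nv_term`), `Grp.isConst_or_isRem_of_complete`, `Grp.not_isConst_of_isRem`, `initGrps` (one component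
  per observable), **`cterms_init_sound`**.
HONEST SCOPE.  (a) Components are linked by CONTRACTIONS (covariance brackets between legs, vertices attributed to the
component whose leg brought them down); print's components are geometric (cubes covering the observables and the
random-walk regions, contractions having finite range after the `C_loc` split) — with one covariance of unrestricted
range the contraction graph is the available notion.  (b) One covariance: the random-walk completeness trigger does not
occur.  (c) A fixed order of integrations by parts (first incomplete component, its first leg); print leaves it free
(*"We can arrange the construction so that the {X_c} are determined once the remainder components are specified"* — the
resummation `Σ Π_c F^L(X_c)` over terms with the same remainder components is NOT done here).  (d) No estimates.  NOT
summit progress; NOT continuum; NOT Clay.  Imports `BIJ88VertexExpansion311` only; modifies nothing.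
-/

noncomputable section

namespace Literature.MathematicalPhysics.QuantumFieldTheory.BalabanImbrieJaffe1984to88.BIJ88VertexComponents311

open MeasureTheory Matrix Finset
open scoped BigOperators
open Literature.MathematicalPhysics.QuantumFieldTheory.Balaban1983to89
open B2Eq228Conditioning (weight source)
open BIJ88VertexIbp311 (lmono vexp)

variable {S : Type} [Fintype S] {ι : Type} [Fintype ι]

/-! ## §1  Components -/

/-- **A component of a term** (a connected component of `X`, p. 311): its pending (uncontracted) legs, the number of
contractions to `χ′` made in it, the number of interaction vertices differentiated down in it.
[cite: BalabanImbrieJaffe1988, §5.14 p.311] -/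
structure Grp (S : Type) : Type where
  /-- pending legs of the component -/
  pend : List (S → ℝ)
  /-- contractions to `χ′` that occurred in the component -/
  nchi : ℕ
  /-- interactions differentiated down in the component -/
  nv : ℕ

/-- The empty component (default value for list access). [folklore] -/
instance : Inhabited (Grp S) := ⟨⟨[], 0, 0⟩⟩

/-- **"A connected component of X is called complete if a contraction to χ′ occurs, …, if at least m̄+1 interactions have
been differentiated down, or if the term is constant (all legs contracted)"** (`M = m̄+1`).
[cite: BalabanImbrieJaffe1988, §5.14 p.311] -/
def Grp.complete (M : ℕ) (g : Grp S) : Bool := g.pend.isEmpty || decide (0 < g.nchi) || decide (M ≤ g.nv)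

/-- **Constant component**: all legs contracted, no `χ′`, at most `m̄` vertices (*"The other components are called
constant components {X_c}"*). [cite: BalabanImbrieJaffe1988, §5.14 p.311] -/
def Grp.IsConst (M : ℕ) (g : Grp S) : Prop := g.pend = [] ∧ g.nchi = 0 ∧ g.nv < M

/-- **Remainder component**: a contraction to `χ′` occurred or at least `m̄+1` interactions were differentiated down
(*"called remainder components {X_r}"*). [cite: BalabanImbrieJaffe1988, §5.14 p.311] -/
def Grp.IsRem (M : ℕ) (g : Grp S) : Prop := 0 < g.nchi ∨ M ≤ g.nv

/-- **Merging two components** when a leg of the first contracts to the `j`-th pending leg of the second (the covariance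
joins them): pending legs, `χ′`-counts and vertex counts add up. [cite: BalabanImbrieJaffe1988, §5.14 p.311] -/
def Grp.merge (L : List (S → ℝ)) (g h : Grp S) (j : ℕ) : Grp S :=
  ⟨L ++ h.pend.eraseIdx j, g.nchi + h.nchi, g.nv + h.nv⟩

/-- **A term of the component expansion**: the coefficient (product of all contraction weights), the directions of the
`χ′`-contractions in chronological order (the cutoff factor of the term is `(Π ∂_z)χ`), and its complete components.
[cite: BalabanImbrieJaffe1988, §5.14 p.311–312] -/
structure CTerm (S : Type) : Type where
  /-- product of the contraction weights -/
  coef : ℝ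
  /-- directions of the contractions to `χ′`, earliest first -/
  dirs : List (S → ℝ)
  /-- the complete components -/
  groups : List (Grp S)
  /-- total number of interaction vertices differentiated down in the history of the term -/
  nv : ℕ

/-- Multiply the coefficient. [cite: BalabanImbrieJaffe1988, §5.14 p.311] -/
def CTerm.scale (a : ℝ) (t : CTerm S) : CTerm S := ⟨a * t.coef, t.dirs, t.groups, t.nv⟩

/-- Record an earlier contraction to `χ′` in direction `z`. [cite: BalabanImbrieJaffe1988, §5.14 p.311] -/
def CTerm.push (z : S → ℝ) (t : CTerm S) : CTerm S := ⟨t.coef, z :: t.dirs, t.groups, t.nv⟩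

/-- Record an earlier differentiated-down vertex. [cite: BalabanImbrieJaffe1988, §5.14 p.311] -/
def CTerm.bump (t : CTerm S) : CTerm S := ⟨t.coef, t.dirs, t.groups, t.nv + 1⟩

/-! ## §2  The termination potential -/

/-- The maximal number of legs of a vertex. [cite: BalabanImbrieJaffe1988, §5.14 p.311] -/
def maxArity (legs : ι → List (S → ℝ)) : ℕ := univ.sup fun m => (legs m).length

omit [Fintype S] in
/-- Every vertex has at most `maxArity` legs. [cite: BalabanImbrieJaffe1988, §5.14 p.311] -/
theorem length_legs_le (legs : ι → List (S → ℝ)) (m : ι) : (legs m).length ≤ maxArity legs :=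
  Finset.le_sup (f := fun m => (legs m).length) (mem_univ m)

/-- Weight of a component still to be worked on: pending legs, one for setting it aside, and `A` per vertex it
may still differentiate down (the termination measure behind *"After sufficiently many integrations by parts, all
components of X will be complete"*). [cite: BalabanImbrieJaffe1988, §5.14 p.311] -/
def gw (M A : ℕ) (g : Grp S) : ℕ := g.pend.length + 1 + (M - g.nv) * A

/-- The potential: every step of the expansion lowers it (*"After sufficiently many integrations by parts, all
components of X will be complete"*). [cite: BalabanImbrieJaffe1988, §5.14 p.311] -/
def pot (M A : ℕ) (done todo : List (Grp S)) : ℕ :=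
  (todo.map (gw M A)).sum + (done.map fun g => g.pend.length).sum

omit [Fintype S] in
/-- Removing the `k`-th entry from a sum. [folklore] -/
private theorem sum_map_eraseIdx_add {β : Type} (w : β → ℕ) (d : β) : ∀ (l : List β) {k : ℕ}, k < l.length →
    ((l.eraseIdx k).map w).sum + w (l.getD k d) = (l.map w).sum
  | [], _, h => by simp at h
  | x :: l, 0, _ => by simp [add_comm]
  | x :: l, k + 1, h => by
    simp only [List.eraseIdx_cons_succ, List.map_cons, List.sum_cons, List.getD_cons_succ, List.length_cons] at h ⊢
    have := sum_map_eraseIdx_add w d l (k := k) (by omega)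
    omega

omit [Fintype S] in
/-- An incomplete component has pending legs and fewer than `M` vertices. [cite: BalabanImbrieJaffe1988, §5.14 p.311] -/
theorem Grp.nv_lt_of_not_complete {M : ℕ} {g : Grp S} (hc : ¬ g.complete M = true) : g.nv < M := by
  simp only [Grp.complete, Bool.or_eq_true, decide_eq_true_eq, not_or, not_le] at hc
  exact hc.2

omit [Fintype S] in
/-- Setting a complete component aside lowers the potential. [cite: BalabanImbrieJaffe1988, §5.14 p.311] -/
theorem pot_move (M A : ℕ) (done rest : List (Grp S)) (g : Grp S) :
    pot M A (done ++ [g]) rest < pot M A done (g :: rest) := by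
  simp only [pot, List.map_append, List.sum_append, List.map_cons, List.sum_cons, List.map_nil, List.sum_nil, gw]
  omega

omit [Fintype S] in
/-- Replacing the head component by one with fewer pending legs (same vertex count) lowers the potential.
[cite: BalabanImbrieJaffe1988, §5.14 p.311] -/
theorem pot_head_lt (M A : ℕ) (done rest : List (Grp S)) {g g' : Grp S} (hnv : g'.nv = g.nv)
    (hlen : g'.pend.length < g.pend.length) : pot M A done (g' :: rest) < pot M A done (g :: rest) := by
  simp only [pot, List.map_cons, List.sum_cons, gw, hnv]
  omega

omit [Fintype S] in
/-- Merging the head component with another incomplete one lowers the potential. [cite: BalabanImbrieJaffe1988, §5.14 p.311] -/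
theorem pot_merge_rest (M A : ℕ) (done rest : List (Grp S)) (g : Grp S) {u : S → ℝ} {L : List (S → ℝ)}
    (hp : g.pend = u :: L) {k : ℕ} (hk : k < rest.length) (j : ℕ) :
    pot M A done (Grp.merge L g (rest.getD k default) j :: rest.eraseIdx k) < pot M A done (g :: rest) := by
  have hs := sum_map_eraseIdx_add (gw M A) default rest hk
  set h := rest.getD k default
  have h1 : (M - (g.nv + h.nv)) * A ≤ (M - g.nv) * A :=
    Nat.mul_le_mul_right _ (Nat.sub_le_sub_left (Nat.le_add_right _ _) _)
  have h2 := List.length_eraseIdx_le h.pend j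
  simp only [pot, List.map_cons, List.sum_cons, gw, Grp.merge, List.length_append, hp, List.length_cons] at hs ⊢
  omega

omit [Fintype S] in
/-- Merging the head component with a complete one lowers the potential. [cite: BalabanImbrieJaffe1988, §5.14 p.311] -/
theorem pot_merge_done (M A : ℕ) (done rest : List (Grp S)) (g : Grp S) {u : S → ℝ} {L : List (S → ℝ)}
    (hp : g.pend = u :: L) {k : ℕ} (hk : k < done.length) (j : ℕ) :
    pot M A (done.eraseIdx k) (Grp.merge L g (done.getD k default) j :: rest) < pot M A done (g :: rest) := by
  have hs := sum_map_eraseIdx_add (fun g : Grp S => g.pend.length) default done hk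
  set h := done.getD k default
  have h1 : (M - (g.nv + h.nv)) * A ≤ (M - g.nv) * A :=
    Nat.mul_le_mul_right _ (Nat.sub_le_sub_left (Nat.le_add_right _ _) _)
  have h2 := List.length_eraseIdx_le h.pend j
  simp only [pot, List.map_cons, List.sum_cons, gw, Grp.merge, List.length_append, hp, List.length_cons] at hs ⊢
  omega

omit [Fintype S] in
/-- Differentiating down a vertex (fewer than `M` so far) lowers the potential. [cite: BalabanImbrieJaffe1988, §5.14 p.311] -/
theorem pot_vertex (M : ℕ) (legs : ι → List (S → ℝ)) (done rest : List (Grp S)) (g : Grp S) {u : S → ℝ}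
    {L : List (S → ℝ)} (hp : g.pend = u :: L) (hnv : g.nv < M) (m : ι) (j : ℕ) :
    pot M (maxArity legs) done (⟨L ++ (legs m).eraseIdx j, g.nchi, g.nv + 1⟩ :: rest)
      < pot M (maxArity legs) done (g :: rest) := by
  have e : M - g.nv = (M - (g.nv + 1)) + 1 := by omega
  have h1 := List.length_eraseIdx_le (legs m) j
  have h2 := length_legs_le legs m
  simp only [pot, List.map_cons, List.sum_cons, gw, List.length_append, hp, List.length_cons, e, Nat.add_mul, one_mul]
  omega

variable [DecidableEq S]

/-- **THE EXPANSION WITH PRINT'S STOPPING RULE PER COMPONENT** (p. 311, all components): the state is the list `done` of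
complete components and the list `todo` of the others; the head component is worked on — if complete it is set aside
(*"We stop integrating by parts fields in complete components of X"*), otherwise its head leg `Φ(u)` is integrated by
parts: it contracts (1) to another pending leg of the same component, (2) to a pending leg of another incomplete
component or (3) of a complete one — THE TWO COMPONENTS MERGE (counts add) —, (4) to the source, (5) to `χ′` (the
component's `χ′`-count rises: complete), or (6) to the vertex `m` through its leg `j` (the other legs join the
component, its vertex count rises; at `m̄+1` it is complete).  No incomplete component left: TERMINAL (*"After
sufficiently many integrations by parts, all components of X will be complete"* — well-founded on the potential `pot`).
[cite: BalabanImbrieJaffe1988, §5.14 p.311] -/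
def cterms (A : Matrix S S ℝ) (f : S → ℝ) (c : ι → ℝ) (legs : ι → List (S → ℝ)) (M : ℕ) :
    List (Grp S) → List (Grp S) → List (CTerm S)
  | done, [] => [⟨1, [], done, 0⟩]
  | done, g :: rest =>
    if _hc : g.complete M = true then cterms A f c legs M (done ++ [g]) rest
    else
      match _hp : g.pend with
      | [] => []
      | u :: L =>
        -- (1) to another pending leg of the same component
        ((range L.length).toList.flatMap fun i =>
          (cterms A f c legs M done (⟨L.eraseIdx i, g.nchi, g.nv⟩ :: rest)).map
            (CTerm.scale ((A⁻¹ *ᵥ u) ⬝ᵥ L.getD i 0)))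
        -- (2) to a pending leg of another incomplete component: merge
        ++ ((range rest.length).toList.flatMap fun k =>
          if _hk : k < rest.length then
            (range (rest.getD k default).pend.length).toList.flatMap fun j =>
              (cterms A f c legs M done
                  (Grp.merge L g (rest.getD k default) j :: rest.eraseIdx k)).map
                (CTerm.scale ((A⁻¹ *ᵥ u) ⬝ᵥ (rest.getD k default).pend.getD j 0))
          else [])
        -- (3) to a pending leg of a complete component: merge (the merged component is complete)
        ++ ((range done.length).toList.flatMap fun k =>
          if _hk : k < done.length then
            (range (done.getD k default).pend.length).toList.flatMap fun j =>
              (cterms A f c legs M (done.eraseIdx k)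
                  (Grp.merge L g (done.getD k default) j :: rest)).map
                (CTerm.scale ((A⁻¹ *ᵥ u) ⬝ᵥ (done.getD k default).pend.getD j 0))
          else [])
        -- (4) to the source
        ++ (cterms A f c legs M done (⟨L, g.nchi, g.nv⟩ :: rest)).map (CTerm.scale ((A⁻¹ *ᵥ u) ⬝ᵥ f))
        -- (5) to χ′
        ++ (cterms A f c legs M done (⟨L, g.nchi + 1, g.nv⟩ :: rest)).map (CTerm.push (A⁻¹ *ᵥ u))
        -- (6) to the interaction: a vertex differentiated down, its other legs join the component
        ++ ((univ : Finset ι).toList.flatMap fun m => (range (legs m).length).toList.flatMap fun j =>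
          (cterms A f c legs M done (⟨L ++ (legs m).eraseIdx j, g.nchi, g.nv + 1⟩ :: rest)).map
            fun t => (t.scale (-(c m * ((A⁻¹ *ᵥ u) ⬝ᵥ (legs m).getD j 0)))).bump)
  termination_by done todo => pot M (maxArity legs) done todo
  decreasing_by
    · exact pot_move _ _ _ _ _
    · exact pot_head_lt _ _ _ _ rfl (by simp only [_hp, List.length_cons]; have := List.length_eraseIdx_le L i; omega)
    · exact pot_merge_rest _ _ _ _ _ _hp _hk _
    · exact pot_merge_done _ _ _ _ _ _hp _hk _
    · exact pot_head_lt _ _ _ _ rfl (by simp only [_hp, List.length_cons]; omega)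
    · exact pot_head_lt _ _ _ _ rfl (by simp only [_hp, List.length_cons]; omega)
    · exact pot_vertex M legs done rest g _hp (Grp.nv_lt_of_not_complete _hc) m j


/-! ## §3  What the stopping rule guarantees -/

omit [Fintype S] [DecidableEq S] in
/-- Scaling the coefficient keeps the components (bookkeeping). [cite: BalabanImbrieJaffe1988, §5.14 p.311] -/
@[simp] theorem CTerm.scale_groups (a : ℝ) (t : CTerm S) : (t.scale a).groups = t.groups := rfl
omit [Fintype S] [DecidableEq S] in
/-- Scaling the coefficient keeps the `χ′`-directions (bookkeeping). [cite: BalabanImbrieJaffe1988, §5.14 p.311] -/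
@[simp] theorem CTerm.scale_dirs (a : ℝ) (t : CTerm S) : (t.scale a).dirs = t.dirs := rfl
omit [Fintype S] [DecidableEq S] in
/-- Scaling multiplies the coefficient (bookkeeping). [cite: BalabanImbrieJaffe1988, §5.14 p.311] -/
@[simp] theorem CTerm.scale_coef (a : ℝ) (t : CTerm S) : (t.scale a).coef = a * t.coef := rfl
omit [Fintype S] [DecidableEq S] in
/-- Recording a `χ′`-direction keeps the components (bookkeeping). [cite: BalabanImbrieJaffe1988, §5.14 p.311] -/
@[simp] theorem CTerm.push_groups (z : S → ℝ) (t : CTerm S) : (t.push z).groups = t.groups := rfl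
omit [Fintype S] [DecidableEq S] in
/-- Recording a `χ′`-direction prepends it (bookkeeping). [cite: BalabanImbrieJaffe1988, §5.14 p.311] -/
@[simp] theorem CTerm.push_dirs (z : S → ℝ) (t : CTerm S) : (t.push z).dirs = z :: t.dirs := rfl
omit [Fintype S] [DecidableEq S] in
/-- Recording a `χ′`-direction keeps the coefficient (bookkeeping). [cite: BalabanImbrieJaffe1988, §5.14 p.311] -/
@[simp] theorem CTerm.push_coef (z : S → ℝ) (t : CTerm S) : (t.push z).coef = t.coef := rfl

omit [Fintype S] [DecidableEq S] in
/-- Counting a vertex keeps the components (bookkeeping). [cite: BalabanImbrieJaffe1988, §5.14 p.311] -/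
@[simp] theorem CTerm.bump_groups (t : CTerm S) : t.bump.groups = t.groups := rfl
omit [Fintype S] [DecidableEq S] in
/-- Counting a vertex keeps the `χ′`-directions (bookkeeping). [cite: BalabanImbrieJaffe1988, §5.14 p.311] -/
@[simp] theorem CTerm.bump_dirs (t : CTerm S) : t.bump.dirs = t.dirs := rfl
omit [Fintype S] [DecidableEq S] in
/-- Counting a vertex keeps the coefficient (bookkeeping). [cite: BalabanImbrieJaffe1988, §5.14 p.311] -/
@[simp] theorem CTerm.bump_coef (t : CTerm S) : t.bump.coef = t.coef := rfl
omit [Fintype S] [DecidableEq S] in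
/-- Counting a vertex raises the vertex count by one (bookkeeping). [cite: BalabanImbrieJaffe1988, §5.14 p.311] -/
@[simp] theorem CTerm.bump_nv (t : CTerm S) : t.bump.nv = t.nv + 1 := rfl
omit [Fintype S] [DecidableEq S] in
/-- Scaling keeps the vertex count (bookkeeping). [cite: BalabanImbrieJaffe1988, §5.14 p.311] -/
@[simp] theorem CTerm.scale_nv (a : ℝ) (t : CTerm S) : (t.scale a).nv = t.nv := rfl
omit [Fintype S] [DecidableEq S] in
/-- Recording a `χ′`-direction keeps the vertex count (bookkeeping). [cite: BalabanImbrieJaffe1988, §5.14 p.311] -/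
@[simp] theorem CTerm.push_nv (z : S → ℝ) (t : CTerm S) : (t.push z).nv = t.nv := rfl

omit [Fintype S] [DecidableEq S] in
/-- An incomplete component has a head leg. [cite: BalabanImbrieJaffe1988, §5.14 p.311] -/
theorem Grp.pend_ne_nil_of_not_complete {M : ℕ} {g : Grp S} (hc : ¬ g.complete M = true) : g.pend ≠ [] := by
  intro h
  simp [Grp.complete, h] at hc

/-- **WHAT THE STOPPING RULE GUARANTEES** (p. 311–312): in every term of the component expansion started from complete
components `done` and arbitrary components `todo`, (i) EVERY component is complete — no pending leg (then it is
constant or remainder according to its counts), or a contraction to `χ′` occurred in it, or at least `M = m̄+1`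
interactions were differentiated down in it; (ii) the `χ′`-directions of the term are exactly accounted for by the
components' `χ′`-counts: `Σ_groups nchi = Σ_{done ++ todo} nchi + |dirs|`. [cite: BalabanImbrieJaffe1988, §5.14 p.311–312] -/
theorem cterms_sound (A : Matrix S S ℝ) (f : S → ℝ) (c : ι → ℝ) (legs : ι → List (S → ℝ)) (M : ℕ) :
    ∀ (n : ℕ) (done todo : List (Grp S)), pot M (maxArity legs) done todo < n →
      (∀ h ∈ done, h.complete M = true) → ∀ t ∈ cterms A f c legs M done todo,
        (∀ h ∈ t.groups, h.complete M = true) ∧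
          (t.groups.map Grp.nchi).sum = ((done ++ todo).map Grp.nchi).sum + t.dirs.length ∧
          (t.groups.map Grp.nv).sum = ((done ++ todo).map Grp.nv).sum + t.nv
  | 0, _, _, hn, _ => fun _ _ => absurd hn (Nat.not_lt_zero _)
  | n + 1, done, [], _, hd => by
    intro t ht
    rw [cterms, List.mem_singleton] at ht
    subst ht
    exact ⟨hd, by simp, by simp⟩
  | n + 1, done, g :: rest, hn, hd => by
    intro t ht
    have hn' : pot M (maxArity legs) done (g :: rest) ≤ n := Nat.lt_succ_iff.1 hn
    have IH : ∀ done' todo', pot M (maxArity legs) done' todo' < pot M (maxArity legs) done (g :: rest) →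
        (∀ h ∈ done', h.complete M = true) → ∀ t ∈ cterms A f c legs M done' todo',
          (∀ h ∈ t.groups, h.complete M = true) ∧
            (t.groups.map Grp.nchi).sum = ((done' ++ todo').map Grp.nchi).sum + t.dirs.length ∧
            (t.groups.map Grp.nv).sum = ((done' ++ todo').map Grp.nv).sum + t.nv :=
      fun done' todo' hlt hd' => cterms_sound A f c legs M n done' todo' (lt_of_lt_of_le hlt hn') hd'
    rw [cterms] at ht
    split at ht
    · -- the head component is complete: set aside
      rename_i hc
      have hd' : ∀ h ∈ done ++ [g], h.complete M = true := fun h hh => by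
        rcases List.mem_append.1 hh with hh | hh
        · exact hd h hh
        · rw [List.mem_singleton.1 hh]; exact hc
      obtain ⟨h1, h2, h3⟩ := IH _ _ (pot_move _ _ _ _ _) hd' t ht
      refine ⟨h1, ?_, ?_⟩
      · rw [h2]
        simp [List.map_append, List.sum_append, add_left_comm]
      · rw [h3]
        simp [List.map_append, List.sum_append, add_left_comm]
    · rename_i hc
      split at ht
      · exact absurd ‹g.pend = []› (Grp.pend_ne_nil_of_not_complete hc)
      · rename_i u L hp
        have hnv : g.nv < M := Grp.nv_lt_of_not_complete hc
        -- the bookkeeping identity of the counts, used in every case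
        have hsum : ∀ (done' : List (Grp S)) (g' : Grp S) (rest' : List (Grp S)),
            ((done' ++ g' :: rest').map Grp.nchi).sum
              = (done'.map Grp.nchi).sum + g'.nchi + (rest'.map Grp.nchi).sum := fun done' g' rest' => by
          simp [List.map_append, List.sum_append, add_assoc]
        have hsumv : ∀ (done' : List (Grp S)) (g' : Grp S) (rest' : List (Grp S)),
            ((done' ++ g' :: rest').map Grp.nv).sum
              = (done'.map Grp.nv).sum + g'.nv + (rest'.map Grp.nv).sum := fun done' g' rest' => by
          simp [List.map_append, List.sum_append, add_assoc]
        simp only [List.mem_append, List.mem_flatMap, List.mem_map, Finset.mem_toList, Finset.mem_range,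
          Finset.mem_univ, true_and] at ht
        rcases ht with (((((⟨i, -, t', ht', rfl⟩ | ⟨k, hk, hmem⟩) | ⟨k, hk, hmem⟩) | ⟨t', ht', rfl⟩) | ⟨t', ht', rfl⟩) |
          ⟨m, j, -, t', ht', rfl⟩)
        · -- (1) another leg of the same component
          obtain ⟨h1, h2⟩ := IH _ _ (pot_head_lt M (maxArity legs) done rest (g := g)
            (g' := ⟨L.eraseIdx i, g.nchi, g.nv⟩) rfl
            (by simp only [hp, List.length_cons]; have := List.length_eraseIdx_le L i; omega)) hd t' ht'
          refine ⟨h1, ?_, ?_⟩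
          · rw [CTerm.scale_groups, CTerm.scale_dirs, h2.1]
            simp only [hsum]
          · rw [CTerm.scale_groups, CTerm.scale_nv, h2.2]
            simp only [hsumv]
        · -- (2) a leg of another incomplete component: merge
          rw [dif_pos hk] at hmem
          simp only [List.mem_flatMap, List.mem_map, Finset.mem_toList, Finset.mem_range] at hmem
          obtain ⟨j, -, t', ht', rfl⟩ := hmem
          obtain ⟨h1, h2⟩ := IH _ _ (pot_merge_rest _ _ _ _ _ hp hk _) hd t' ht'
          refine ⟨h1, ?_, ?_⟩
          · have hs := sum_map_eraseIdx_add Grp.nchi default rest hk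
            rw [CTerm.scale_groups, CTerm.scale_dirs, h2.1]
            simp only [hsum, Grp.merge]
            omega
          · have hs := sum_map_eraseIdx_add Grp.nv default rest hk
            rw [CTerm.scale_groups, CTerm.scale_nv, h2.2]
            simp only [hsumv, Grp.merge]
            omega
        · -- (3) a leg of a complete component: merge
          rw [dif_pos hk] at hmem
          simp only [List.mem_flatMap, List.mem_map, Finset.mem_toList, Finset.mem_range] at hmem
          obtain ⟨j, -, t', ht', rfl⟩ := hmem
          have hd' : ∀ h ∈ done.eraseIdx k, h.complete M = true := fun h hh => hd h (List.mem_of_mem_eraseIdx hh)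
          obtain ⟨h1, h2⟩ := IH _ _ (pot_merge_done _ _ _ _ _ hp hk _) hd' t' ht'
          refine ⟨h1, ?_, ?_⟩
          · have hs := sum_map_eraseIdx_add Grp.nchi default done hk
            rw [CTerm.scale_groups, CTerm.scale_dirs, h2.1]
            simp only [hsum, Grp.merge]
            omega
          · have hs := sum_map_eraseIdx_add Grp.nv default done hk
            rw [CTerm.scale_groups, CTerm.scale_nv, h2.2]
            simp only [hsumv, Grp.merge]
            omega
        · -- (4) the source
          obtain ⟨h1, h2⟩ := IH _ _ (pot_head_lt M (maxArity legs) done rest (g := g) (g' := ⟨L, g.nchi, g.nv⟩) rfl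
            (by simp only [hp, List.length_cons]; omega)) hd t' ht'
          refine ⟨h1, ?_, ?_⟩
          · rw [CTerm.scale_groups, CTerm.scale_dirs, h2.1]
            simp only [hsum]
          · rw [CTerm.scale_groups, CTerm.scale_nv, h2.2]
            simp only [hsumv]
        · -- (5) χ′: the component's χ′-count rises
          obtain ⟨h1, h2⟩ := IH _ _ (pot_head_lt M (maxArity legs) done rest (g := g) (g' := ⟨L, g.nchi + 1, g.nv⟩)
            rfl (by simp only [hp, List.length_cons]; omega)) hd t' ht'
          refine ⟨h1, ?_, ?_⟩
          · rw [CTerm.push_groups, CTerm.push_dirs, h2.1, List.length_cons]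
            simp only [hsum]
            omega
          · rw [CTerm.push_groups, CTerm.push_nv, h2.2]
            simp only [hsumv]
        · -- (6) a vertex differentiated down
          obtain ⟨h1, h2⟩ := IH _ _ (pot_vertex M legs done rest g hp hnv m j) hd t' ht'
          refine ⟨h1, ?_, ?_⟩
          · rw [CTerm.bump_groups, CTerm.scale_groups, CTerm.bump_dirs, CTerm.scale_dirs, h2.1]
            simp only [hsum]
          · rw [CTerm.bump_groups, CTerm.scale_groups, CTerm.bump_nv, CTerm.scale_nv, h2.2]
            simp only [hsumv]
            omega


omit [Fintype S] [DecidableEq S] in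
/-- **A complete component is constant or remainder** (p. 311: *"The components containing contractions to χ′ … or at
least m̄+1 interactions are called remainder components {X_r}. The other components are called constant components
{X_c}"*). [cite: BalabanImbrieJaffe1988, §5.14 p.311] -/
theorem Grp.isConst_or_isRem_of_complete {M : ℕ} {g : Grp S} (h : g.complete M = true) :
    g.IsConst M ∨ g.IsRem M := by
  simp only [Grp.complete, Bool.or_eq_true, List.isEmpty_iff, decide_eq_true_eq] at h
  by_cases hr : 0 < g.nchi ∨ M ≤ g.nv
  · exact Or.inr hr
  · rcases h with (h | h) | h
    · refine Or.inl ⟨h, ?_, ?_⟩ <;> omega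
    · exact absurd (Or.inl h) hr
    · exact absurd (Or.inr h) hr

omit [Fintype S] [DecidableEq S] in
/-- A remainder component is not constant. [cite: BalabanImbrieJaffe1988, §5.14 p.311] -/
theorem Grp.not_isConst_of_isRem {M : ℕ} {g : Grp S} (h : g.IsRem M) : ¬ g.IsConst M := by
  rintro ⟨-, h0, hlt⟩
  rcases h with h | h <;> omega

/-- **The initial state of (5.14.1)'s integration by parts**: one component per observable `F_{k,loc}(X_{σ_i})` (its
legs), no `χ′`, no vertex yet. [cite: BalabanImbrieJaffe1988, §5.14 p.311] -/
def initGrps (obs : List (List (S → ℝ))) : List (Grp S) := obs.map fun L => ⟨L, 0, 0⟩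

/-- **Classification of the terms of the expansion of a product of observables**: every component of every term is
complete (hence constant or remainder, `Grp.isConst_or_isRem_of_complete`), the `χ′`-directions are counted by the
components' `χ′`-counts, and the vertices by their vertex counts. [cite: BalabanImbrieJaffe1988, §5.14 p.311–312] -/
theorem cterms_init_sound (A : Matrix S S ℝ) (f : S → ℝ) (c : ι → ℝ) (legs : ι → List (S → ℝ)) (M : ℕ)
    (obs : List (List (S → ℝ))) :
    ∀ t ∈ cterms A f c legs M [] (initGrps obs),
      (∀ h ∈ t.groups, h.complete M = true) ∧ (t.groups.map Grp.nchi).sum = t.dirs.length ∧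
        (t.groups.map Grp.nv).sum = t.nv := by
  intro t ht
  obtain ⟨h1, h2, h3⟩ := cterms_sound A f c legs M _ [] (initGrps obs) (Nat.lt_succ_self _)
    (fun h hh => by simp at hh) t ht
  have e0 : ((initGrps (S := S) obs).map Grp.nchi).sum = 0 := by
    simp [initGrps, List.map_map, Function.comp_def]
  have e0' : ((initGrps (S := S) obs).map Grp.nv).sum = 0 := by
    simp [initGrps, List.map_map, Function.comp_def]
  simp only [List.nil_append, e0, e0', zero_add] at h2 h3
  exact ⟨h1, h2, h3⟩

end Literature.MathematicalPhysics.QuantumFieldTheory.BalabanImbrieJaffe1984to88.BIJ88VertexComponents311
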